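import Summits.NavierStokesRegularity.NavierStokesRegularity.Theses.CorkscrewDynamo
import Summits.NavierStokesRegularity.NavierStokesRegularity.Theorems.CorkscrewDynamoSphereTangentLiouvilleRepresentative
import Summits.NavierStokesRegularity.NavierStokesRegularity.Theorems.CorkscrewDynamoSphereTangentLiouvilleSlices
import Summits.NavierStokesRegularity.NavierStokesRegularity.Theorems.CorkscrewDynamoSphereTangentLiouvilleScaleBound
import Summits.NavierStokesRegularity.NavierStokesRegularity.Theorems.CorkscrewDynamoSphereTangentLiouvilleVorticity
import Summits.NavierStokesRegularity.NavierStokesRegularity.Theorems.CorkscrewDynamoSphereTangentLiouvilleMaxPrinciple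
import Summits.NavierStokesRegularity.NavierStokesRegularity.Theorems.CorkscrewDynamoSphereTangentLiouvilleHodge
import HarnessLib

/-!
# `SphereTangentLiouville` (item stmt-NavierStokesRegularity-1365, route CorkscrewDynamo): proof

**Theorem.** A Type I rotated-`λ`-DSS ancient mild solution of Navier–Stokes (`ν = 1`, duality
form, measurable slices; any `λ > 1`, any linear isometry `R`) which is everywhere tangent to the
spheres about the origin (`⟪x, u(t,x)⟫ = 0` for `t < 0`) vanishes: `u(t) = 0` a.e. for every
`t < 0` — the toroidal-velocity anti-dynamo theorem (Elsasser, Bullard–Gellman) transplanted to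
Type I ancient solutions. The proof is UNCONDITIONAL (KNSS 2009 §4 is a theorem of the tree).

Assembly (physical variables):
1. Shift time by `δ > 0`: `v(t) = u(t − δ)` is a bounded ancient mild solution with the decay
   `r‖v‖ ≤ C₀`, tangent slices, and the conjugated covariance `v(t,x) = λRᵀv(λ²(t−δ)+δ, λRx)`.
2. `CorkscrewDynamoSphereTangentLiouvilleRepresentative/Slices`: the normalised KNSS representative
   `V` — smooth, divergence free, tangent at every `t`, `v(t) = V(t)` a.e. at EVERY `t < 0`, with
   the vorticity equation in integrated form and time-Lipschitz derivatives.
3. `…ScaleBound`: the covariance passes to `V` and gives `‖DV(t)‖ ≤ λ²δA/(δ−t)`.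
4. `…Vorticity`: `g = ⟪x, curl V⟫` solves `∂ₜg = Δg − Dg[V]` classically, with
   `|g(t,x)| ≤ C₁|x|/(−t)`.
5. `…MaxPrinciple`: `g ≡ 0` (radial barriers are invisible to the tangent drift).
6. `…Hodge`: a smooth tangent divergence-free field with tangent curl vanishes, so `V(t) = 0`,
   `v(t) = 0` a.e., i.e. `u(s) = 0` a.e. for all `s < −δ`; `δ` was arbitrary.
-/

noncomputable section

open MeasureTheory Set Function Filter InnerProductSpace Metric
open scoped RealInnerProductSpace Topology Laplacian ContDiff
open Literature.Analysis Literature.Analysis.FluidPDE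

set_option linter.dupNamespace false

namespace Summit.NavierStokesRegularity.NavierStokesRegularity.Theorems

/-- The cylindrical radius is at most the norm. -/
theorem cylRadius_le_norm' (x : EuclideanSpace ℝ (Fin 3)) : cylRadius x ≤ ‖x‖ := by
  have h : cylRadius x ^ 2 ≤ ‖x‖ ^ 2 := by
    rw [cylRadius_sq, EuclideanSpace.real_norm_sq_eq, Fin.sum_univ_three]
    nlinarith [sq_nonneg (x 2)]
  exact (pow_le_pow_iff_left₀ (cylRadius_nonneg x) (norm_nonneg x) two_ne_zero).1 h

/-- **The shifted field.** For a Type I ancient mild solution `u` (duality form, measurable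
slices) tangent to the spheres and rotated `c`-DSS, and `δ > 0`, the field `v(t) = u(t − δ)` is
a bounded ancient mild solution with measurable slices, the decay `r‖v(t,x)‖ ≤ C₀`, tangent
slices, and the conjugated covariance `v(t, x) = c Rᵀ v(c²(t − δ) + δ, c R x)`. -/
theorem shifted_field {c δ C₀ : ℝ}
    {R : EuclideanSpace ℝ (Fin 3) ≃ₗᵢ[ℝ] EuclideanSpace ℝ (Fin 3)}
    {u : ℝ → EuclideanSpace ℝ (Fin 3) → EuclideanSpace ℝ (Fin 3)} (hδ : 0 < δ)
    (hmild : IsAncientMildSolution 1 u) (hmeas : ∀ t < 0, AEStronglyMeasurable (u t) volume)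
    (hrdss : IsRotatedDSS c R u) (hC₀ : HasTypeIDecay C₀ u) (htan : ∀ t < 0, ∀ x, ⟪x, u t x⟫ = 0) :
    IsBoundedAncientMildSolution 1 (fun t x => u (t - δ) x) ∧
    (∀ t < 0, AEStronglyMeasurable ((fun t x => u (t - δ) x) t) volume) ∧
    (∃ C : ℝ, ∀ t < 0, ∀ x, cylRadius x * ‖(fun t x => u (t - δ) x) t x‖ ≤ C) ∧
    (∀ t < 0, ∀ x, ⟪x, (fun t x => u (t - δ) x) t x⟫ = 0) ∧
    (∀ t x, (fun t x => u (t - δ) x) t x =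
      c • R.symm ((fun t x => u (t - δ) x) (c ^ 2 * (t - δ) + δ) (c • R x))) := by
  have hC₀0 : 0 ≤ C₀ := by
    have h := hC₀ (-1) (by norm_num) 0
    rw [norm_zero, zero_add, neg_neg, Real.sqrt_one, div_one] at h
    exact (norm_nonneg _).trans h
  refine ⟨⟨?_, ?_⟩, fun t ht => hmeas (t - δ) (by linarith), ⟨C₀, fun t ht x => ?_⟩,
    fun t ht x => htan (t - δ) (by linarith) x, fun t x => ?_⟩
  · simpa only [sub_eq_add_neg] using hmild.time_translate (s := -δ) (by linarith)
  · obtain ⟨K, hK⟩ := (hC₀.hasTypeITimeDecay hC₀0).isBoundedOn hC₀0 hδ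
    exact ⟨K, fun t ht x => hK (t - δ) (by simp only [mem_Iio] at ht ⊢; linarith) x⟩
  · have h := hC₀ (t - δ) (by linarith) x
    have hs : 0 < Real.sqrt (-(t - δ)) := Real.sqrt_pos.2 (by linarith)
    have hden : 0 < ‖x‖ + Real.sqrt (-(t - δ)) := by positivity
    calc cylRadius x * ‖u (t - δ) x‖ ≤ ‖x‖ * (C₀ / (‖x‖ + Real.sqrt (-(t - δ)))) :=
          mul_le_mul (cylRadius_le_norm' x) h (norm_nonneg _) (norm_nonneg _)
      _ ≤ C₀ := by
          rw [mul_div_assoc', div_le_iff₀ hden]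
          nlinarith [norm_nonneg x, hs.le]
  · show u (t - δ) x = c • R.symm (u (c ^ 2 * (t - δ) + δ - δ) (c • R x))
    rw [add_sub_cancel_right]
    exact (hrdss (t - δ) x).symm

/-- **Steps 4–5: `⟪x, curl V(t, x)⟫ ≡ 0`** for a family with smooth slices tangent to the spheres,
time-Lipschitz derivatives, locally time-Lipschitz values, the integrated vorticity equation with
drift `V`, and the scale-invariant gradient bound `‖DV(t, x)‖ ≤ K/(−t)`: the scalar
`g = ⟪x, curl V⟫` solves `∂ₜg = Δg − Dg[V]` classically with `|g| ≤ ‖curl‖ K |x|/(−t)`, and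
`tangentDrift_eq_zero` applies. -/
theorem inner_curl_eq_zero_of_family
    {V : ℝ → EuclideanSpace ℝ (Fin 3) → EuclideanSpace ℝ (Fin 3)} {K : ℝ}
    (hVsm : ∀ t < 0, ContDiff ℝ ∞ (V t))
    (hVlip : ∀ k : ℕ, 1 ≤ k → ∃ L : ℝ, ∀ s < 0, ∀ t < 0, ∀ x,
      ‖iteratedFDeriv ℝ k (V t) x - iteratedFDeriv ℝ k (V s) x‖ ≤ L * |t - s|)
    (hVlip0 : ∃ L : ℝ, ∀ s < 0, ∀ t < 0, ∀ x, ‖V t x - V s x‖ ≤ L * (‖x‖ + 3) * |t - s|)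
    (hVvort : ∀ x, ∀ s t : ℝ, s ≤ t → t < 0 →
      curl (V t) x - curl (V s) x =
        ∫ τ in s..t, ((Δ (curl (V τ))) x - fderiv ℝ (curl (V τ)) x (V τ x) +
          fderiv ℝ (V τ) x (curl (V τ) x)))
    (hVtan : ∀ t < 0, ∀ x, ⟪x, V t x⟫ = 0)
    (hK : ∀ t < 0, ∀ x, ‖fderiv ℝ (V t) x‖ ≤ K / (-t)) :
    ∀ t < 0, ∀ x, ⟪x, curl (V t) x⟫ = 0 := by
  have hV1 : ∀ t < 0, ContDiff ℝ 1 (V t) := fun t ht => (hVsm t ht).of_le (by norm_cast)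
  have hV3 : ∀ t < 0, ContDiff ℝ 3 (V t) := fun t ht => (hVsm t ht).of_le (by norm_cast)
  have hK0 : 0 ≤ K := by
    have h := hK (-1) (by norm_num) 0
    rw [neg_neg, div_one] at h
    exact (norm_nonneg _).trans h
  obtain ⟨L₁, hL₁⟩ := hVlip 1 le_rfl
  refine tangentDrift_eq_zero (g := fun t x => ⟪x, curl (V t) x⟫)
    (gt := fun t x => ⟪x, (Δ (curl (V t))) x - fderiv ℝ (curl (V t)) x (V t x) +
      fderiv ℝ (V t) x (curl (V t) x)⟫)
    (Vd := V) (C₁ := ‖curlCLM‖ * K) ?_ ?_ ?_ ?_ hVtan ?_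
  · intro t ht
    exact contDiff_inner_curl (hV3 t ht)
  · exact continuousOn_uncurry_inner_curl hV1 hL₁
  · intro t ht x
    have h := (hasDerivAt_const t x).inner ℝ (hasDerivAt_curl hVsm hVlip hVlip0 hVvort t ht x)
    simpa using h
  · intro t ht x
    exact inner_vorticityRHS_eq (hV3 t ht) (hVtan t ht) x
  · intro t ht x
    have h1 : ‖curl (V t) x‖ ≤ ‖curlCLM‖ * (K / (-t)) :=
      (norm_curl_le (V t) x).trans (mul_le_mul_of_nonneg_left (hK t ht x) (norm_nonneg curlCLM))
    calc |⟪x, curl (V t) x⟫| ≤ ‖x‖ * ‖curl (V t) x‖ := abs_real_inner_le_norm _ _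
      _ ≤ ‖x‖ * (‖curlCLM‖ * (K / (-t))) := mul_le_mul_of_nonneg_left h1 (norm_nonneg x)
      _ = ‖curlCLM‖ * K * ‖x‖ / (-t) := by ring

/-- **`SphereTangentLiouville` holds** (item stmt-NavierStokesRegularity-1365 of route
CorkscrewDynamo; see the module docstring for the assembly). -/
theorem sphereTangentLiouville_proof :
    Summit.NavierStokesRegularity.NavierStokesRegularity.Theses.CorkscrewDynamo.SphereTangentLiouville := by
  unfold Summit.NavierStokesRegularity.NavierStokesRegularity.Theses.CorkscrewDynamo.SphereTangentLiouville
  intro c R u hc hmild hmeas hrdss hC htan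
  obtain ⟨C₀, hC₀⟩ := hC
  -- it suffices to treat every time shift `δ > 0`
  suffices key : ∀ δ : ℝ, 0 < δ → ∀ s < 0, (fun x => u (s - δ) x) =ᵐ[volume] (0 : EuclideanSpace ℝ (Fin 3) → EuclideanSpace ℝ (Fin 3)) by
    intro t ht
    have h := key (-t / 2) (by linarith) (t / 2) (by linarith)
    have e : t / 2 - -t / 2 = t := by ring
    rw [e] at h
    exact h
  intro δ hδ
  obtain ⟨hv, hvmeas, hvdecay, hvtan, hvrdss⟩ := shifted_field hδ hmild hmeas hrdss hC₀ htan
  -- the representative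
  obtain ⟨V, hVsm, hVdiv, hVbdd, hVlip, ⟨L, -, hVlip0⟩, hVvort, hVae, hVtan_ae⟩ :=
    exists_tangent_representative_ae hv hvmeas hvdecay hvtan
  have hVtan : ∀ t < 0, ∀ x, ⟪x, V t x⟫ = 0 := forall_tangent_of_ae hVlip0 hVtan_ae
  have hV1 : ∀ t < 0, ContDiff ℝ 1 (V t) := fun t ht => (hVsm t ht).of_le (by norm_cast)
  have hV2 : ∀ t < 0, ContDiff ℝ 2 (V t) := fun t ht => (hVsm t ht).of_le (by norm_cast)
  have hV3 : ∀ t < 0, ContDiff ℝ 3 (V t) := fun t ht => (hVsm t ht).of_le (by norm_cast)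
  obtain ⟨M, hM⟩ := hVbdd 0
  have hVM : ∀ t < 0, ∀ x, ‖V t x‖ ≤ M := fun t ht x => by
    have := hM t ht x
    rwa [norm_iteratedFDeriv_zero] at this
  have hvV : ∀ t < 0, (fun t x => u (t - δ) x) t =ᵐ[volume] V t :=
    ae_eq_slice_of_ae hv hvmeas hvtan hV1 hVdiv hVM hVlip0 hVtan hVae
  -- the scale-invariant gradient bound
  have hcov := rdss_of_ae_eq hc.le hδ.le hvV hvrdss fun t ht => (hV1 t ht).continuous
  have hnorm := norm_fderiv_of_rdss hc.le hδ.le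
    (fun t ht => (hV1 t ht).differentiable one_ne_zero) hcov
  obtain ⟨A, hA'⟩ := hVbdd 1
  have hA : ∀ t < 0, ∀ x, ‖fderiv ℝ (V t) x‖ ≤ A := fun t ht x => by
    have := hA' t ht x
    rwa [norm_iteratedFDeriv_one] at this
  have hscale := norm_fderiv_le_of_rdss hc hδ hnorm hA
  -- `⟪x, curl V⟫ ≡ 0` (transport equation + maximum principle)
  have hK : ∀ t < 0, ∀ x, ‖fderiv ℝ (V t) x‖ ≤ (c ^ 2 * δ * A) / (-t) := by
    intro t ht x
    have hA0 : 0 ≤ A := (norm_nonneg _).trans (hA (-1) (by norm_num) 0)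
    refine (hscale t ht x).trans ?_
    exact div_le_div_of_nonneg_left (by positivity) (by linarith) (by linarith)
  have hg0 : ∀ t < 0, ∀ x, ⟪x, curl (V t) x⟫ = 0 :=
    inner_curl_eq_zero_of_family hVsm hVlip ⟨L, hVlip0⟩ hVvort hVtan hK
  -- the sphere-Hodge lemma at every slice
  have hV0 : ∀ t < 0, V t = 0 := fun t ht =>
    eq_zero_of_tangent_of_divFree_of_inner_curl_eq_zero (hV2 t ht) (hVtan t ht) (hVdiv t ht) (hg0 t ht)
  intro s hs
  have h := hvV s hs
  rw [hV0 s hs] at h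
  exact h

end Summit.NavierStokesRegularity.NavierStokesRegularity.Theorems
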